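import Literature.NumberTheory.EllipticCurves.TwoDescent
import Literature.NumberTheory.EllipticCurves.TianYuanZhang2017.CurveAFourTorsion
import Summits.BirchSwinnertonDyer.Rank1Residual.P2.CongruentNumberThetaDescentBlocks
import HarnessLib

/-!
# `ζ₈ ∉ ℍ′_n` FOR EVERY ODD `n`, FROM LEMMA 3.18 ALONE — the hypothesis `hi8 : sqClass D.im ≠ 1` of the exact-descent criteria DISCHARGED
# (crux stmt-BirchSwinnertonDyer-20509 `RamifiedOffTYZOfFacts`, line `offtyz-v7`, LEAD cruxlead-20509 g30, cycle 31, part B1)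

HONEST FRAMING (cell `bsd-print-cf2`, route `PrintCf2`; `--supports stmt-BirchSwinnertonDyer-20509`; theorems only, `def`-free, no `sorry`, no named
fact introduced).  BSD is not proved by any of this; no class is closed by this file; item 23431 (C⁺) and crux 20509 stay OPEN.

g26–g29 stated every exact-descent criterion for C⁺ on the visible R2 rows (`…GenusPeriodExactDescent`, `…GenusPeriodDescent`,
`…GenusPeriodDescentR2`, `…GenusPeriodKummerR2`) under the hypothesis **`hi8 : sqClass D.im ≠ 1`** — «`i` is not a square in `ℍ′_n`», i.e.
«`ζ₈ ∉ ℍ′_n`» — and g29's memo listed its discharge "from displays on R2" as a next step.  It needs NO class-field input and NO restriction to R2: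
it is a consequence of the displayed **Lemma 3.18** (`GenusPointData.lemma318`, a conjunct of `Printed`: for `n` odd every torsion point `Q` of
`A(ℍ′_n)` has `2Q ∈ {0, τ(1)}`) and the tree's explicit `4`-torsion point `ptQ = (2i(1+√2), (2√2+4)(1−i))` of `CurveAFourTorsion` with
`2·ptQ = T⁺ = (2i, 0)`:

* §1 `sq_ne_two` — **for `n` odd, `2` is not a square in `ℍ′_n`**: a square root `s` of `2` makes `ptQ ∈ A(ℍ′_n)`, a torsion point with
  `2·ptQ = (2i, 0) ∉ {0, τ(1) = (0,0)}`, contradicting Lemma 3.18.  (In `2`-descent language: the complete `2`-descent class of `T⁺` is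
  `([2i], [−8], [4i]) = (1, [i], [i]) = (1, [2], [2])`, so `T⁺ ∈ 2A(F) ⟺ √2 ∈ F ⟺ ζ₈ ∈ F` for `F ∋ i`.)
* §2 `sq_ne_im` — **`i` is not a square in `ℍ′_n`** (`s² = i ⟹ (s(1 − i))² = 2`); `sq_ne_neg_im`, `sq_ne_neg_two` (the same class).
* §3 ★ `sqClass_im_ne_one` — THE HYPOTHESIS `hi8` BY NAME, for every package `D : GenusPointData n` with `D.lemma318`, `n` odd; and the fact-free
  identity `sqClass_two_eq_sqClass_im` (`2 = −i·(1+i)²`): the classes `[2] = [−2] = [i] = [−i]` coincide and are the ONE non-trivial class this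
  file is about.
* §4 `sqClass_im_ne_one_of_printed` — the form consumed by the R2 criteria (`D.Printed`, `n = lq` odd).

So in `GenusPeriodTraceNorm.levelTwo_iff_not_torsion_and_secondNorm_of_visible_R2_of_facts` (p801252) and its relatives the binder `hi8` is now
free of charge (part B3 of this cycle restates the criterion without it).  For EVEN `n` the opposite holds (`√−2, i ∈ ℍ′_n`, so `ζ₈ ∈ ℍ′_n` and
`#A(ℍ′_n)[4] = 16`, `CurveAFourTorsion.card_four_torsion_of_data`) — consistent with Lemma 3.18's case split.

References: [cite: TianYuanZhang2017, Lemma 3.18 (arXiv:1411.4728 chunk p0017 L152–L153), Lemma 3.16 (p0017 L98–L113), §3.1 (p0011 L60–L66)];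
[cite: SilvermanAEC2009, III.2.3 (duplication), Prop. X.1.4 (complete 2-descent)]; tree: `TianYuanZhang2017/CurveAFourTorsion` (`ptQ`, `two_nsmul_ptQ`),
`TianYuanZhang2017/GenusPointDescentDisplays` (`lemma318`), `EllipticCurves/TwoDescent` (`sqClass`), `P2/CongruentNumberThetaDescentBlocks` (`im_ne_zero`).
-/

noncomputable section

open scoped Classical

open WeierstrassCurve WeierstrassCurve.Affine WeierstrassCurve.Affine.Point
  Literature.NumberTheory.EllipticCurves
  Literature.NumberTheory.EllipticCurves.TianYuanZhang2017
  Summit.BirchSwinnertonDyer.Rank1Residual.P2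

set_option autoImplicit false

namespace Summit.BirchSwinnertonDyer.PrintCf2.ZetaEight

variable {n : ℕ}

/-! ## §1 `√2 ∉ ℍ′_n` for `n` odd -/

/-- `(2i, 0) ≠ O`. [cite: TianYuanZhang2017, Lemma 3.16 (p0017 L98–L101)] -/
theorem ptTwoI_ne_zero {H : Type} [Field H] [CharZero H] (im : H) (him : im ^ 2 = -1) : (ptTwoI im him : APoint H) ≠ 0 := by
  rw [ptTwoI]; exact Point.some_ne_zero _

/-- `(2i, 0) ≠ τ(1) = (0, 0)` (`i ≠ 0`). [cite: TianYuanZhang2017, Lemma 3.16 (p0017 L98–L113)] -/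
theorem ptTwoI_ne_tauOne {H : Type} [Field H] [CharZero H] (im : H) (him : im ^ 2 = -1) : (ptTwoI im him : APoint H) ≠ tauOne := by
  intro h
  rw [ptTwoI, tauOne] at h
  have hx : 2 * im = 0 := ((Point.some.injEq _ _ _ _ _ _).mp h).1
  have him0 : im = 0 := by
    rcases mul_eq_zero.mp hx with h2 | h2
    · norm_num at h2
    · exact h2
  rw [him0] at him
  norm_num at him

/-- **For `n` odd, `2` is NOT a square in `ℍ′_n`** — from Lemma 3.18 alone: a square root `s` of `2` puts the `4`-torsion point
`ptQ = (2i(1+s), (2s+4)(1−i))` in `A(ℍ′_n)`, and `2·ptQ = (2i, 0) ∉ {0, τ(1)}`.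
[cite: TianYuanZhang2017, Lemma 3.18 (p0017 L152–L153)] [cite: SilvermanAEC2009, III.2.3, Prop. X.1.4] -/
theorem sq_ne_two (D : GenusPointData n) (hodd : Odd n) (h318 : D.lemma318) (s : D.H) : s ^ 2 ≠ 2 := by
  intro hs
  have h4 : (4 : ℕ) • ptQ D.im s D.im_sq hs = 0 := four_nsmul_ptQ D.im s D.im_sq hs
  have hfin : IsOfFinAddOrder (ptQ D.im s D.im_sq hs) := isOfFinAddOrder_iff_nsmul_eq_zero.mpr ⟨4, by norm_num, h4⟩
  obtain ⟨-, h2⟩ := (h318.1 hodd) _ hfin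
  rw [two_nsmul_ptQ] at h2
  rcases h2 with h | h
  · exact ptTwoI_ne_zero D.im D.im_sq h
  · exact ptTwoI_ne_tauOne D.im D.im_sq h

/-- For `n` odd, `−2` is not a square in `ℍ′_n` (`s² = −2 ⟹ (s·i)² = 2`). [cite: TianYuanZhang2017, Lemma 3.18 (p0017 L152–L153)] -/
theorem sq_ne_neg_two (D : GenusPointData n) (hodd : Odd n) (h318 : D.lemma318) (s : D.H) : s ^ 2 ≠ -2 := by
  intro hs
  apply sq_ne_two D hodd h318 (s * D.im)
  rw [mul_pow, hs, D.im_sq]; ring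

/-! ## §2 `i` is not a square in `ℍ′_n` for `n` odd (`ζ₈ ∉ ℍ′_n`) -/

/-- **For `n` odd, `i` is NOT a square in `ℍ′_n`, i.e. `ζ₈ ∉ ℍ′_n`** (`s² = i ⟹ (s(1 − i))² = i(1 − i)² = 2`).
[cite: TianYuanZhang2017, Lemma 3.18 (p0017 L152–L153)] [cite: SilvermanAEC2009, III.2.3, Prop. X.1.4] -/
theorem sq_ne_im (D : GenusPointData n) (hodd : Odd n) (h318 : D.lemma318) (s : D.H) : s ^ 2 ≠ D.im := by
  intro hs
  apply sq_ne_two D hodd h318 (s * (1 - D.im))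
  rw [mul_pow, hs]
  linear_combination (D.im - 2) * D.im_sq

/-- For `n` odd, `−i` is not a square in `ℍ′_n` (`s² = −i ⟹ (s·i)² = i`). [cite: TianYuanZhang2017, Lemma 3.18 (p0017 L152–L153)] -/
theorem sq_ne_neg_im (D : GenusPointData n) (hodd : Odd n) (h318 : D.lemma318) (s : D.H) : s ^ 2 ≠ -D.im := by
  intro hs
  apply sq_ne_im D hodd h318 (s * D.im)
  rw [mul_pow, hs, D.im_sq]; ring

/-- For `n` odd there is no `ζ ∈ ℍ′_n` with `ζ⁴ = −1` (no primitive `8`-th root of unity): `(ζ²)² = −1 = i²` forces `ζ² = ±i`.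
[cite: TianYuanZhang2017, Lemma 3.18 (p0017 L152–L153)] -/
theorem pow_four_ne_neg_one (D : GenusPointData n) (hodd : Odd n) (h318 : D.lemma318) (ζ : D.H) : ζ ^ 4 ≠ -1 := by
  intro h
  have h2 : (ζ ^ 2) ^ 2 = D.im ^ 2 := by rw [D.im_sq, ← h]; ring
  rcases sq_eq_sq_iff_eq_or_eq_neg.mp h2 with e | e
  · exact sq_ne_im D hodd h318 ζ e
  · exact sq_ne_neg_im D hodd h318 ζ e

/-! ## §3 The square class `[i] = [2]` is non-trivial: `hi8` BY NAME -/

/-- ★ **`hi8` DISCHARGED: for `n` odd and every package `D` with Lemma 3.18, `sqClass D.im ≠ 1`** (`i ∉ ℍ′_n^{×2}`, `ζ₈ ∉ ℍ′_n`).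
[cite: TianYuanZhang2017, Lemma 3.18 (p0017 L152–L153)] [cite: SilvermanAEC2009, Prop. X.1.4] -/
theorem sqClass_im_ne_one (D : GenusPointData n) (hodd : Odd n) (h318 : D.lemma318) : sqClass D.im ≠ 1 := by
  intro h
  obtain ⟨u, hu⟩ := (sqClass_eq_one_iff (ThetaDescent.im_ne_zero D)).mp h
  exact sq_ne_im D hodd h318 u hu.symm

/-- For `n` odd, `sqClass (2 : ℍ′_n) ≠ 1`. [cite: TianYuanZhang2017, Lemma 3.18 (p0017 L152–L153)] -/
theorem sqClass_two_ne_one (D : GenusPointData n) (hodd : Odd n) (h318 : D.lemma318) : sqClass (2 : D.H) ≠ 1 := by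
  intro h
  obtain ⟨u, hu⟩ := (sqClass_eq_one_iff (two_ne_zero)).mp h
  exact sq_ne_two D hodd h318 u hu.symm

/-- Fact-free: **`[2] = [i]` in `ℍ′_n^×/ℍ′_n^{×2}`** (`2·i = (1+i)²`, and `[a] = [a]⁻¹`). [cite: SilvermanAEC2009, Prop. X.1.4 (the group K^×/K^{×2})] -/
theorem sqClass_two_eq_sqClass_im (D : GenusPointData n) : sqClass (2 : D.H) = sqClass D.im := by
  have h : (2 : D.H) * D.im * 1 = (1 + D.im) ^ 2 := by linear_combination (-1 : D.H) * D.im_sq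
  have h1 := sqClass_eq_mul_of_mul_mul_eq_sq (two_ne_zero) (ThetaDescent.im_ne_zero D) one_ne_zero h
  rw [show (1 : D.H) = 1 ^ 2 by ring, sqClass_sq] at h1
  -- `1 = [2]·[i]`, so `[2] = [i]` (exponent 2)
  have h2 : sqClass (2 : D.H) * sqClass D.im * sqClass D.im = 1 * sqClass D.im := by rw [← h1]
  rwa [mul_assoc, SqUnits.mul_self, SqUnits.mul_one, SqUnits.one_mul] at h2

/-- Fact-free: `[−1] = 1` in `ℍ′_n` (`−1 = i²`), hence `[−a] = [a]`. [cite: SilvermanAEC2009, Prop. X.1.4] -/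
theorem sqClass_neg (D : GenusPointData n) (a : D.H) : sqClass (-a) = sqClass a := by
  by_cases ha : a = 0
  · rw [ha, _root_.neg_zero]
  · rw [show -a = a * (-1) by ring, sqClass_mul ha (by norm_num), show (-1 : D.H) = D.im ^ 2 by rw [D.im_sq], sqClass_sq,
      SqUnits.mul_one]

/-! ## §4 The forms consumed by the R2 criteria -/

/-- ★ **`hi8` for a `Printed` package on an odd `n`**: `D.Printed → Odd n → sqClass D.im ≠ 1`.
[cite: TianYuanZhang2017, Lemma 3.18 (p0017 L152–L153)] -/
theorem sqClass_im_ne_one_of_printed (D : GenusPointData n) (hPr : D.Printed) (hodd : Odd n) : sqClass D.im ≠ 1 :=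
  sqClass_im_ne_one D hodd hPr.2.2.2.2.2.2.2.2.1

/-- ★ **`hi8` on the two-prime sectors**: for odd primes `l`, `q` and `n = lq`, every `Printed` package has `sqClass D.im ≠ 1`.
[cite: TianYuanZhang2017, Lemma 3.18 (p0017 L152–L153)] -/
theorem sqClass_im_ne_one_two_primes {l q : ℕ} (hl2 : l % 2 = 1) (hq2 : q % 2 = 1) (hn : n = l * q)
    (D : GenusPointData n) (hPr : D.Printed) : sqClass D.im ≠ 1 := by
  have hodd : Odd n := by
    rw [hn, Nat.odd_mul]; exact ⟨Nat.odd_iff.mpr hl2, Nat.odd_iff.mpr hq2⟩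
  exact sqClass_im_ne_one_of_printed D hPr hodd

/-- **No element of `ℍ′_n` squares to `i·t²` with `t ≠ 0`** (`n` odd) — the shape in which `hi8` is used inside the criteria
(`N₀ = s²` and `N₀·i = s′²` cannot both hold for `N₀ ≠ 0`). [cite: TianYuanZhang2017, Lemma 3.18 (p0017 L152–L153)] -/
theorem not_sq_and_mul_im_sq (D : GenusPointData n) (hodd : Odd n) (h318 : D.lemma318) {a : D.H} (ha : a ≠ 0) :
    ¬ ((∃ s : D.H, a = s ^ 2) ∧ ∃ s : D.H, a * D.im = s ^ 2) := by
  rintro ⟨⟨s, hs⟩, ⟨s', hs'⟩⟩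
  have hs0 : s ≠ 0 := by rintro rfl; exact ha (by rw [hs]; ring)
  apply sq_ne_im D hodd h318 (s' / s)
  rw [div_pow, ← hs', ← hs]
  field_simp

end Summit.BirchSwinnertonDyer.PrintCf2.ZetaEight

end
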